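import Literature.NumberTheory.LFunctions.RealCharacterDivisorSums
import Mathlib.NumberTheory.ArithmeticFunction.Moebius
import Mathlib.Data.Nat.Factorization.Induction
import HarnessLib

/-!
# Level of distribution of `r = χ ∗ 1`: `∑_{n ≤ x, d ∣ n} r(n) = g(d) L(1,χ) x + O(q τ(d)² √(x/d))`

Topic `Literature/NumberTheory/LFunctions`, continuing `RealCharacterDivisorSums.lean`
(`r = charDivisorSum χ`, `|∑_{n ≤ t} r(n) − L(1,χ) t| ≤ 5q√t`). Everything is PROVED and
elementary. For a quadratic character `χ` mod `q` and a squarefree modulus `d`, the sum of `r`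
over the multiples of `d` is a signed combination of unrestricted sums:

* `RealChar.ite_dvd_charDivisorSum_prime` — at a prime `p` and every `n`:
  `[p ∣ n] r(n) = r(p) [p ∣ n] r(n/p) − χ(p) [p² ∣ n] r(n/p²)`
  (from `r(p^{v+2}) = r(p) r(p^{v+1}) − χ(p) r(p^v)`, `charDivisorSum_prime_pow_add_two`);
* `RealChar.ite_dvd_charDivisorSum` — for squarefree `d` and every `n`:
  `[d ∣ n] r(n) = ∑_{h ∣ d} μ(h) χ(h) r(d/h) [dh ∣ n] r(n/(dh))` (induction on the prime
  factors of `d`);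
* `RealChar.congrSum_charDivisorSum_eq` — summing over `n ≤ N`:
  `A_d(N) := ∑_{n ≤ N, d ∣ n} r(n) = ∑_{h ∣ d} μ(h) χ(h) r(d/h) · ∑_{m ≤ N/(dh)} r(m)`;
* `RealChar.charDivisorDensity χ = g`, the multiplicative density
  `g(d) = d⁻¹ ∑_{h ∣ d} μ(h)χ(h) h⁻¹ r(d/h)`, with `g(p) = ((1 + χ(p)) − χ(p)/p)/p`, i.e.
  `1 − g(p) = (1 − 1/p)(1 − χ(p)/p)` (`one_sub_charDivisorDensity_prime`);
* `RealChar.abs_congrSum_charDivisorSum_sub_le` — **the remainder bound**: for quadratic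
  `χ ≠ χ₀` mod `q`, squarefree `d` and real `x > 0`,
  `|A_d(x) − g(d) L(1,χ) x| ≤ 5q √x τ(d)²/√d`.

This is the "Type I information" for the non-negative multiplicative sequence `r(n)` (the
ideal-counting function of a quadratic field, Davenport Ch. 6), in the shape consumed by the tree's
sieve framework (`Literature.NumberTheory.Sieve.SieveSequence`: `A_d = g(d) X + R_d`).

## References

* H. Davenport, *Multiplicative Number Theory*, 2nd ed., GTM 74 (1980), Ch. 6. [DavenportMNT1980]
* H. Halberstam, H.-E. Richert, *Sieve Methods* (1974), Ch. 1 (the axiom `A_d = ω(d)X/d + R_d`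
  for multiplicative sequences). [HalberstamRichert1974]
-/

noncomputable section

open Finset ArithmeticFunction
open scoped ArithmeticFunction.zeta ArithmeticFunction.Moebius

namespace Literature.NumberTheory.LFunctions.RealChar

open DirichletAbel

variable {q : ℕ} [NeZero q] (χ : DirichletCharacter ℂ q)

/-! ### The recursion at a prime -/

omit [NeZero q] in
/-- `r(p^{v+2}) = r(p) r(p^{v+1}) − χ(p) r(p^v)` (geometric sums `r(p^k) = ∑_{j ≤ k} χ(p)^j`).
[cite: DavenportMNT1980, Ch. 6] -/
theorem charDivisorSum_prime_pow_add_two (hq : χ ^ 2 = 1) {p : ℕ} (hp : p.Prime) (v : ℕ) :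
    charDivisorSum χ (p ^ (v + 1 + 1)) =
      charDivisorSum χ p * charDivisorSum χ (p ^ (v + 1)) - reChar χ p * charDivisorSum χ (p ^ v) := by
  rw [charDivisorSum_prime χ hq hp, charDivisorSum_prime_pow χ hq hp, charDivisorSum_prime_pow χ hq hp,
    charDivisorSum_prime_pow χ hq hp, sum_range_succ _ (v + 1 + 1), sum_range_succ _ (v + 1)]
  ring

omit [NeZero q] in
/-- **The recursion at a prime**: for `p` prime, quadratic `χ` and every `n`,
`[p ∣ n] r(n) = r(p) · [p ∣ n] r(n/p) − χ(p) · [p² ∣ n] r(n/p²)` (write `n = p^v m`, `p ∤ m`,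
and use multiplicativity with `charDivisorSum_prime_pow_add_two`). [cite: DavenportMNT1980, Ch. 6] -/
theorem ite_dvd_charDivisorSum_prime (hq : χ ^ 2 = 1) {p : ℕ} (hp : p.Prime) (n : ℕ) :
    (if p ∣ n then charDivisorSum χ n else 0) =
      charDivisorSum χ p * (if p ∣ n then charDivisorSum χ (n / p) else 0) -
        reChar χ p * (if p ^ 2 ∣ n then charDivisorSum χ (n / p ^ 2) else 0) := by
  rcases eq_or_ne n 0 with rfl | hn
  · simp
  have hmul := isMultiplicative_charDivisorSum χ hq
  by_cases hpn : p ∣ n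
  · obtain ⟨v, m, hm, rfl⟩ := Nat.exists_eq_pow_mul_and_not_dvd hn p hp.ne_one
    have hcop : ∀ k, (p ^ k).Coprime m := fun k =>
      Nat.Coprime.pow_left k (hp.coprime_iff_not_dvd.mpr hm)
    have hv : v ≠ 0 := by
      rintro rfl
      rw [pow_zero, one_mul] at hpn
      exact hm hpn
    obtain ⟨w, rfl⟩ := Nat.exists_eq_succ_of_ne_zero hv
    rw [if_pos hpn, if_pos hpn]
    have hdiv1 : p ^ (w + 1) * m / p = p ^ w * m := by
      rw [show p ^ (w + 1) * m = p ^ w * m * p by ring]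
      exact Nat.mul_div_cancel _ hp.pos
    cases w with
    | zero =>
      have h2 : ¬ p ^ 2 ∣ p ^ (0 + 1) * m := by
        rw [zero_add, pow_one, pow_two]
        intro h
        exact hm (Nat.dvd_of_mul_dvd_mul_left hp.pos h)
      rw [if_neg h2, mul_zero, sub_zero, hdiv1, hmul.map_mul_of_coprime (hcop 1),
        hmul.map_mul_of_coprime (hcop 0), pow_zero, pow_one, charDivisorSum_one, one_mul]
    | succ u =>
      have h2 : p ^ 2 ∣ p ^ (u + 1 + 1) * m :=
        (pow_dvd_pow p (by omega : 2 ≤ u + 1 + 1)).mul_right m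
      have hdiv2 : p ^ (u + 1 + 1) * m / p ^ 2 = p ^ u * m := by
        rw [show p ^ (u + 1 + 1) * m = p ^ u * m * p ^ 2 by ring]
        exact Nat.mul_div_cancel _ (pow_pos hp.pos 2)
      rw [if_pos h2, hdiv1, hdiv2, hmul.map_mul_of_coprime (hcop _),
        hmul.map_mul_of_coprime (hcop _), hmul.map_mul_of_coprime (hcop _),
        charDivisorSum_prime_pow_add_two χ hq hp u]
      ring
  · have h2 : ¬ p ^ 2 ∣ n := fun h => hpn ((dvd_pow_self p two_ne_zero).trans h)
    rw [if_neg hpn, if_neg hpn, if_neg h2]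
    ring

/-! ### The level-`d` identity for squarefree `d` -/

/-- Moving a coprime divisibility condition past a division: for `a` coprime to `e`,
`[a ∣ n][e ∣ n] F(n/e) = [e ∣ n][a ∣ n/e] F(n/e)`. [folklore] -/
theorem ite_dvd_ite_dvd_eq {a e : ℕ} (hae : a.Coprime e) (F : ℕ → ℝ) (n : ℕ) :
    (if a ∣ n then (if e ∣ n then F (n / e) else 0) else 0) =
      if e ∣ n then (if a ∣ n / e then F (n / e) else 0) else 0 := by
  by_cases he : e ∣ n
  · obtain ⟨k, rfl⟩ := he
    rcases Nat.eq_zero_or_pos e with rfl | he0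
    · simp
    have hk : e * k / e = k := Nat.mul_div_cancel_left k he0
    rw [if_pos (dvd_mul_right e k), if_pos (dvd_mul_right e k), hk]
    by_cases ha : a ∣ k
    · rw [if_pos ha, if_pos (ha.mul_left e)]
    · rw [if_neg ha, if_neg (fun h => ha (hae.dvd_of_dvd_mul_left h))]
  · rw [if_neg he, if_neg he]
    split_ifs <;> rfl

/-- Pushing `[e ∣ n]` into a level sum: `[e ∣ n] ∑_h C_h [a h ∣ n/e] F(n/e/(ah)) =
∑_h C_h [e a h ∣ n] F(n/(e a h))`. [folklore] -/
theorem ite_dvd_sum_eq (e a : ℕ) (S : Finset ℕ) (C : ℕ → ℝ) (F : ℕ → ℝ) (n : ℕ) :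
    (if e ∣ n then ∑ h ∈ S, C h * (if a * h ∣ n / e then F (n / e / (a * h)) else 0) else 0) =
      ∑ h ∈ S, C h * (if e * (a * h) ∣ n then F (n / (e * (a * h))) else 0) := by
  by_cases he : e ∣ n
  · rw [if_pos he]
    refine sum_congr rfl fun h _ => ?_
    have hiff : a * h ∣ n / e ↔ e * (a * h) ∣ n := Nat.dvd_div_iff_mul_dvd he
    by_cases h1 : a * h ∣ n / e
    · rw [if_pos h1, if_pos (hiff.mp h1), Nat.div_div_eq_div_mul]
    · rw [if_neg h1, if_neg (fun h2 => h1 (hiff.mpr h2))]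
  · rw [if_neg he]
    symm
    refine sum_eq_zero fun h _ => ?_
    rw [if_neg (fun h' => he (Dvd.dvd.trans (dvd_mul_right e _) h')), mul_zero]

/-- Splitting a sum over the divisors of `p · a`, `p` prime, `p ∤ a` (as in the tree's
`Literature.NumberTheory.Sieve.BetaSieve.sum_divisors_mul_prime`). [folklore] -/
theorem sum_divisors_prime_mul {p a : ℕ} (hp : p.Prime) (hpa : ¬ p ∣ a) (f : ℕ → ℝ) :
    ∑ e ∈ (p * a).divisors, f e = ∑ e ∈ a.divisors, (f e + f (e * p)) := by
  have hcop : a.Coprime p := (hp.coprime_iff_not_dvd.mpr hpa).symm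
  rw [mul_comm p a, Nat.Coprime.divisors_mul hcop, Finset.sum_map]
  change ∑ x ∈ (a.divisors ×ˢ p.divisors).attach, f (x.val.1 * x.val.2) = _
  rw [Finset.sum_attach (a.divisors ×ˢ p.divisors) (fun x => f (x.1 * x.2)), Finset.sum_product,
    hp.divisors]
  refine Finset.sum_congr rfl fun e _ => ?_
  rw [Finset.sum_pair hp.one_lt.ne, mul_one]

omit [NeZero q] in
/-- **The level-`d` identity**: for quadratic `χ`, squarefree `d` and every `n`,
`[d ∣ n] r(n) = ∑_{h ∣ d} μ(h) χ(h) r(d/h) · [dh ∣ n] r(n/(dh))`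
(induction on the prime factors of `d`, the step being `ite_dvd_charDivisorSum_prime`).
[cite: DavenportMNT1980, Ch. 6] -/
theorem ite_dvd_charDivisorSum (hq : χ ^ 2 = 1) {d : ℕ} (hd : Squarefree d) (n : ℕ) :
    (if d ∣ n then charDivisorSum χ n else 0) =
      ∑ h ∈ d.divisors, (μ h : ℝ) * reChar χ h * charDivisorSum χ (d / h) *
        (if d * h ∣ n then charDivisorSum χ (n / (d * h)) else 0) := by
  induction d using induction_on_primes generalizing n with
  | zero => exact absurd hd not_squarefree_zero
  | one => simp
  | prime_mul p a hp ih =>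
    rw [Nat.squarefree_mul_iff] at hd
    obtain ⟨hcop, -, ha⟩ := hd
    have hpa : ¬ p ∣ a := (Nat.Prime.coprime_iff_not_dvd hp).mp hcop
    have ha0 : a ≠ 0 := ha.ne_zero
    have hmul := isMultiplicative_charDivisorSum χ hq
    have ih' := fun n => ih ha n
    -- Step 1: `[pa ∣ n] r(n) = [a ∣ n][p ∣ n] r(n)`
    have e1 : (if p * a ∣ n then charDivisorSum χ n else 0) =
        if a ∣ n then (if p ∣ n then charDivisorSum χ n else 0) else 0 := by
      by_cases h : p * a ∣ n
      · rw [if_pos h, if_pos ((dvd_mul_left a p).trans h), if_pos ((dvd_mul_right p a).trans h)]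
      · by_cases ha' : a ∣ n
        · have hp' : ¬ p ∣ n := fun hp' => h (hcop.mul_dvd_of_dvd_of_dvd hp' ha')
          rw [if_neg h, if_pos ha', if_neg hp']
        · rw [if_neg h, if_neg ha']
    -- Step 2: apply the recursion at `p`, distribute `[a ∣ n]`, move it past the divisions
    have e2 : (if a ∣ n then (if p ∣ n then charDivisorSum χ n else 0) else 0) =
        charDivisorSum χ p * (if p ∣ n then (if a ∣ n / p then charDivisorSum χ (n / p) else 0) else 0) -
          reChar χ p *
            (if p ^ 2 ∣ n then (if a ∣ n / p ^ 2 then charDivisorSum χ (n / p ^ 2) else 0) else 0) := by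
      rw [ite_dvd_charDivisorSum_prime χ hq hp n,
        ← ite_dvd_ite_dvd_eq hcop.symm (fun m => charDivisorSum χ m) n,
        ← ite_dvd_ite_dvd_eq (Nat.Coprime.pow_right 2 hcop.symm) (fun m => charDivisorSum χ m) n]
      split_ifs <;> ring
    -- Step 3: induction hypothesis at `n/p` and `n/p²`, then push the outer conditions inside
    have e3 : (if p ∣ n then (if a ∣ n / p then charDivisorSum χ (n / p) else 0) else 0) =
        ∑ h ∈ a.divisors, (μ h : ℝ) * reChar χ h * charDivisorSum χ (a / h) *
          (if p * (a * h) ∣ n then charDivisorSum χ (n / (p * (a * h))) else 0) := by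
      rw [ih' (n / p)]
      exact ite_dvd_sum_eq p a a.divisors _ (fun m => charDivisorSum χ m) n
    have e4 : (if p ^ 2 ∣ n then (if a ∣ n / p ^ 2 then charDivisorSum χ (n / p ^ 2) else 0) else 0) =
        ∑ h ∈ a.divisors, (μ h : ℝ) * reChar χ h * charDivisorSum χ (a / h) *
          (if p ^ 2 * (a * h) ∣ n then charDivisorSum χ (n / (p ^ 2 * (a * h))) else 0) := by
      rw [ih' (n / p ^ 2)]
      exact ite_dvd_sum_eq (p ^ 2) a a.divisors _ (fun m => charDivisorSum χ m) n
    rw [e1, e2, e3, e4, mul_sum, mul_sum, ← sum_sub_distrib, sum_divisors_prime_mul hp hpa]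
    refine sum_congr rfl fun h hh => ?_
    have hhd : h ∣ a := Nat.dvd_of_mem_divisors hh
    have hh0 : h ≠ 0 := Nat.ne_of_gt (Nat.pos_of_mem_divisors hh)
    have hph : ¬ p ∣ h := fun h' => hpa (h'.trans hhd)
    have hcop_ph : h.Coprime p := (hp.coprime_iff_not_dvd.mpr hph).symm
    -- the arithmetic of the two new terms
    have q1 : p * a / h = p * (a / h) := Nat.mul_div_assoc p hhd
    have q2 : p * a / (h * p) = a / h := by
      rw [mul_comm h p]
      exact Nat.mul_div_mul_left a h hp.pos
    have q3 : p * a * h = p * (a * h) := mul_assoc p a h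
    have q4 : p * a * (h * p) = p ^ 2 * (a * h) := by ring
    have hcop_pah : p.Coprime (a / h) :=
      Nat.Coprime.coprime_dvd_right (Nat.div_dvd_of_dvd hhd) hcop
    have r1 : charDivisorSum χ (p * (a / h)) = charDivisorSum χ p * charDivisorSum χ (a / h) :=
      hmul.map_mul_of_coprime hcop_pah
    have m1 : (μ (h * p) : ℝ) = -(μ h : ℝ) := by
      rw [ArithmeticFunction.isMultiplicative_moebius.map_mul_of_coprime hcop_ph,
        ArithmeticFunction.moebius_apply_prime hp]
      push_cast
      ring
    have c1 : reChar χ (h * p) = reChar χ h * reChar χ p := reChar_mul χ hq hh0 hp.ne_zero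
    rw [q1, q2, q3, q4, r1, m1, c1]
    ring

/-! ### Summing over `n ≤ N` -/

/-- Re-indexing the multiples of `e ≥ 1` in `(0, N]`: `∑_{n ≤ N} [e ∣ n] F(n/e) = ∑_{m ≤ N/e} F(m)`.
[folklore] -/
theorem sum_Ioc_ite_dvd {e : ℕ} (he : 0 < e) (N : ℕ) (F : ℕ → ℝ) :
    ∑ n ∈ Ioc 0 N, (if e ∣ n then F (n / e) else 0) = ∑ m ∈ Ioc 0 (N / e), F m := by
  rw [← sum_filter]
  refine sum_nbij' (· / e) (· * e) ?_ ?_ ?_ ?_ ?_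
  · intro n hn
    simp only [mem_filter, mem_Ioc] at hn
    obtain ⟨⟨hn0, hnN⟩, hdvd⟩ := hn
    simp only [mem_Ioc]
    exact ⟨Nat.div_pos (Nat.le_of_dvd hn0 hdvd) he, Nat.div_le_div_right hnN⟩
  · intro m hm
    simp only [mem_Ioc] at hm
    obtain ⟨hm0, hmN⟩ := hm
    simp only [mem_filter, mem_Ioc]
    exact ⟨⟨Nat.mul_pos hm0 he, (Nat.le_div_iff_mul_le he).mp hmN⟩, dvd_mul_left e m⟩
  · intro n hn
    simp only [mem_filter] at hn
    exact Nat.div_mul_cancel hn.2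
  · intro m _
    exact Nat.mul_div_cancel m he
  · intro n _
    rfl

omit [NeZero q] in
/-- **`A_d(N) = ∑_{h ∣ d} μ(h)χ(h) r(d/h) · R(N/(dh))`** for squarefree `d`, where
`A_d(N) = ∑_{n ≤ N, d ∣ n} r(n)` and `R(M) = ∑_{m ≤ M} r(m)`. [cite: DavenportMNT1980, Ch. 6] -/
theorem congrSum_charDivisorSum_eq (hq : χ ^ 2 = 1) {d : ℕ} (hd : Squarefree d) (N : ℕ) :
    ∑ n ∈ (Ioc 0 N).filter (d ∣ ·), charDivisorSum χ n =
      ∑ h ∈ d.divisors, (μ h : ℝ) * reChar χ h * charDivisorSum χ (d / h) *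
        ∑ m ∈ Ioc 0 (N / (d * h)), charDivisorSum χ m := by
  rw [sum_filter, sum_congr rfl fun n _ => ite_dvd_charDivisorSum χ hq hd n, sum_comm]
  refine sum_congr rfl fun h hh => ?_
  rw [← mul_sum]
  congr 1
  have hdh : 0 < d * h := Nat.mul_pos (Nat.pos_of_ne_zero hd.ne_zero) (Nat.pos_of_mem_divisors hh)
  exact sum_Ioc_ite_dvd hdh N _

/-! ### The density `g` -/

/-- Mathlib's arithmetic function `n ↦ 1/n`, spelled `ζ.pdiv id` (pointwise quotient of `ζ` by
the identity; it is also the tree's `Literature.NumberTheory.Sieve.reciprocalDensity`): its value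
is `n⁻¹` at every `n` (including the junk value `0⁻¹ = 0` at `n = 0`). [folklore] -/
theorem zeta_pdiv_id_apply (n : ℕ) :
    ((ζ : ArithmeticFunction ℝ).pdiv (ArithmeticFunction.id : ArithmeticFunction ℝ)) n = (n : ℝ)⁻¹ := by
  rcases eq_or_ne n 0 with rfl | hn
  · simp
  · rw [pdiv_apply, natCoe_apply, natCoe_apply, zeta_apply_ne hn, ArithmeticFunction.id_apply,
      Nat.cast_one, one_div]

/-- `n ↦ 1/n` (as `ζ.pdiv id`) is multiplicative. [folklore] -/
theorem isMultiplicative_zeta_pdiv_id :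
    ((ζ : ArithmeticFunction ℝ).pdiv (ArithmeticFunction.id : ArithmeticFunction ℝ)).IsMultiplicative :=
  isMultiplicative_zeta.natCast.pdiv isMultiplicative_id.natCast

/-- The level coefficient `κ(d) = ∑_{h ∣ d} μ(h) χ(h) h⁻¹ r(d/h)` (`κ = (μχ/id) ∗ r`), so that
the main term of `A_d(N)` is `κ(d) L(1,χ) N/d`. [folklore] -/
def levelCoeff : ArithmeticFunction ℝ :=
  ((μ : ArithmeticFunction ℝ).pmul
    ((reChar χ).pmul ((ζ : ArithmeticFunction ℝ).pdiv (ArithmeticFunction.id : ArithmeticFunction ℝ)))) *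
      charDivisorSum χ

/-- **The density of `r` on multiples of `d`**: `g(d) = κ(d)/d = d⁻¹ ∑_{h ∣ d} μ(h)χ(h)h⁻¹ r(d/h)`,
a multiplicative function with `g(p) = ((1 + χ(p)) − χ(p)/p)/p` (Halberstam–Richert's `ω(d)/d`
for the sequence `r(n)`). [cite: HalberstamRichert1974, Ch. 1] -/
def charDivisorDensity : ArithmeticFunction ℝ :=
  (levelCoeff χ).pmul ((ζ : ArithmeticFunction ℝ).pdiv (ArithmeticFunction.id : ArithmeticFunction ℝ))

omit [NeZero q] in
/-- `κ(d) = ∑_{h ∣ d} μ(h) χ(h) h⁻¹ r(d/h)`. [folklore] -/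
theorem levelCoeff_apply (d : ℕ) :
    levelCoeff χ d = ∑ h ∈ d.divisors, (μ h : ℝ) * reChar χ h * (h : ℝ)⁻¹ * charDivisorSum χ (d / h) := by
  rw [levelCoeff, mul_apply, Nat.sum_divisorsAntidiagonal (fun h k =>
    ((μ : ArithmeticFunction ℝ).pmul ((reChar χ).pmul
      ((ζ : ArithmeticFunction ℝ).pdiv (ArithmeticFunction.id : ArithmeticFunction ℝ)))) h *
        charDivisorSum χ k)]
  refine sum_congr rfl fun x _ => ?_
  simp only [pmul_apply, intCoe_apply, zeta_pdiv_id_apply]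
  ring

omit [NeZero q] in
/-- `g(d) = d⁻¹ ∑_{h ∣ d} μ(h) χ(h) h⁻¹ r(d/h)`. [folklore] -/
theorem charDivisorDensity_apply (d : ℕ) :
    charDivisorDensity χ d =
      (d : ℝ)⁻¹ * ∑ h ∈ d.divisors, (μ h : ℝ) * reChar χ h * (h : ℝ)⁻¹ * charDivisorSum χ (d / h) := by
  rw [charDivisorDensity, pmul_apply, levelCoeff_apply, zeta_pdiv_id_apply, mul_comm]

omit [NeZero q] in
/-- `g` is multiplicative (quadratic `χ`). [folklore] -/
theorem isMultiplicative_charDivisorDensity (hq : χ ^ 2 = 1) :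
    (charDivisorDensity χ).IsMultiplicative :=
  ((ArithmeticFunction.isMultiplicative_moebius.intCast.pmul
    ((isMultiplicative_reChar χ hq).pmul isMultiplicative_zeta_pdiv_id)).mul
      (isMultiplicative_charDivisorSum χ hq)).pmul isMultiplicative_zeta_pdiv_id

omit [NeZero q] in
/-- `g(p) = ((1 + χ(p)) − χ(p)/p)/p` at a prime. [cite: HalberstamRichert1974, Ch. 1] -/
theorem charDivisorDensity_prime (hq : χ ^ 2 = 1) {p : ℕ} (hp : p.Prime) :
    charDivisorDensity χ p = ((1 + reChar χ p) - reChar χ p / p) / p := by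
  rw [charDivisorDensity_apply, hp.divisors, sum_pair hp.one_lt.ne, Nat.div_one,
    Nat.div_self hp.pos, charDivisorSum_prime χ hq hp, charDivisorSum_one, reChar_one,
    ArithmeticFunction.moebius_apply_one, ArithmeticFunction.moebius_apply_prime hp]
  push_cast
  ring

omit [NeZero q] in
/-- **`1 − g(p) = (1 − 1/p)(1 − χ(p)/p)`** at a prime. [cite: HalberstamRichert1974, Ch. 1] -/
theorem one_sub_charDivisorDensity_prime (hq : χ ^ 2 = 1) {p : ℕ} (hp : p.Prime) :
    1 - charDivisorDensity χ p = (1 - (p : ℝ)⁻¹) * (1 - reChar χ p / p) := by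
  rw [charDivisorDensity_prime χ hq hp]
  have hp0 : (p : ℝ) ≠ 0 := by exact_mod_cast hp.ne_zero
  field_simp
  ring

/-! ### The remainder bound -/

omit [NeZero q] in
/-- `τ(d/h) ≤ τ(d)` for `h ∣ d`, `d ≠ 0`, and `0 ≤ r(d/h) ≤ τ(d)`. [folklore] -/
theorem charDivisorSum_div_le_card_divisors (hq : χ ^ 2 = 1) {d h : ℕ} (hd : d ≠ 0) (hh : h ∣ d) :
    |charDivisorSum χ (d / h)| ≤ #d.divisors := by
  rw [abs_of_nonneg (charDivisorSum_nonneg χ hq _)]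
  refine ((le_abs_self _).trans (abs_charDivisorSum_le χ (d / h))).trans ?_
  exact_mod_cast card_le_card (Nat.divisors_subset_of_dvd hd (Nat.div_dvd_of_dvd hh))

/-- **Remainder bound for `r` on multiples of a squarefree `d`**: for quadratic `χ ≠ χ₀` mod
`q`, squarefree `d` and real `x > 0`,
`|∑_{n ≤ x, d ∣ n} r(n) − g(d) L(1,χ) x| ≤ 5q √x τ(d)² / √d`
(each of the `τ(d)` terms `h ∣ d` of `congrSum_charDivisorSum_eq` carries `|μχ| ≤ 1`,
`r(d/h) ≤ τ(d)` and the error `5q√(x/(dh)) ≤ 5q√x/√d` of `abs_sum_charDivisorSum_sub_le`).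
[cite: DavenportMNT1980, Ch. 6] -/
theorem abs_congrSum_charDivisorSum_sub_le (hχ : χ ≠ 1) (hq : χ ^ 2 = 1) {d : ℕ}
    (hd : Squarefree d) {x : ℝ} (hx : 0 < x) :
    |∑ n ∈ (Ioc 0 ⌊x⌋₊).filter (d ∣ ·), charDivisorSum χ n -
        charDivisorDensity χ d * ((χ.LFunction 1).re * x)| ≤
      5 * q * Real.sqrt x * (#d.divisors : ℝ) ^ 2 / Real.sqrt d := by
  set L := (χ.LFunction 1).re with hL
  set τ : ℝ := (#d.divisors : ℝ) with hτ
  have hd0 : d ≠ 0 := hd.ne_zero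
  have hdpos : (0 : ℝ) < d := by exact_mod_cast Nat.pos_of_ne_zero hd0
  have hsd : 0 < Real.sqrt d := Real.sqrt_pos.mpr hdpos
  -- write both terms as sums over `h ∣ d`
  have hmain : charDivisorDensity χ d * (L * x) =
      ∑ h ∈ d.divisors, (μ h : ℝ) * reChar χ h * charDivisorSum χ (d / h) * (L * (x / (d * h))) := by
    rw [charDivisorDensity_apply, mul_comm ((d : ℝ)⁻¹), mul_assoc, sum_mul]
    refine sum_congr rfl fun h _ => ?_
    rw [div_eq_mul_inv, mul_inv]
    ring
  rw [congrSum_charDivisorSum_eq χ hq hd, hmain, ← sum_sub_distrib]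
  -- termwise bound
  have hterm : ∀ h ∈ d.divisors, |(μ h : ℝ) * reChar χ h * charDivisorSum χ (d / h) *
          (∑ m ∈ Ioc 0 (⌊x⌋₊ / (d * h)), charDivisorSum χ m) -
        (μ h : ℝ) * reChar χ h * charDivisorSum χ (d / h) * (L * (x / (d * h)))| ≤
      τ * (5 * q * Real.sqrt x / Real.sqrt d) := by
    intro h hh
    have hhd : h ∣ d := Nat.dvd_of_mem_divisors hh
    have hh1 : (1 : ℝ) ≤ h := by exact_mod_cast Nat.pos_of_mem_divisors hh
    have hdh : (0 : ℝ) < d * h := by positivity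
    rw [← mul_sub, abs_mul]
    -- the coefficient
    have hcoef : |(μ h : ℝ) * reChar χ h * charDivisorSum χ (d / h)| ≤ τ := by
      rw [abs_mul, abs_mul]
      have hμ : |(μ h : ℝ)| ≤ 1 := by exact_mod_cast ArithmeticFunction.abs_moebius_le_one
      calc |(μ h : ℝ)| * |reChar χ h| * |charDivisorSum χ (d / h)| ≤ 1 * 1 * τ := by
            gcongr
            · exact abs_reChar_le_one χ h
            · exact charDivisorSum_div_le_card_divisors χ hq hd0 hhd
        _ = τ := by ring
    -- the error of the unrestricted sum at `x/(dh)`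
    have herr : |(∑ m ∈ Ioc 0 (⌊x⌋₊ / (d * h)), charDivisorSum χ m) - L * (x / (d * h))| ≤
        5 * q * Real.sqrt x / Real.sqrt d := by
      have hfl : ⌊x⌋₊ / (d * h) = ⌊x / ((d * h : ℕ) : ℝ)⌋₊ := (Nat.floor_div_natCast x (d * h)).symm
      have hxdh : 0 < x / ((d * h : ℕ) : ℝ) := by push_cast; positivity
      have h1 := abs_sum_charDivisorSum_sub_le χ hχ hq hxdh
      rw [← hfl] at h1
      push_cast at h1
      refine h1.trans ?_
      have hsh : 1 ≤ Real.sqrt h := Real.one_le_sqrt.mpr hh1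
      rw [Real.sqrt_div hx.le, Real.sqrt_mul hdpos.le, mul_div_assoc]
      refine mul_le_mul_of_nonneg_left ?_ (by positivity)
      exact div_le_div_of_nonneg_left (Real.sqrt_nonneg x) hsd (le_mul_of_one_le_right hsd.le hsh)
    exact mul_le_mul hcoef herr (abs_nonneg _) (by positivity)
  calc _ ≤ ∑ h ∈ d.divisors, |(μ h : ℝ) * reChar χ h * charDivisorSum χ (d / h) *
            (∑ m ∈ Ioc 0 (⌊x⌋₊ / (d * h)), charDivisorSum χ m) -
          (μ h : ℝ) * reChar χ h * charDivisorSum χ (d / h) * (L * (x / (d * h)))| :=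
        abs_sum_le_sum_abs _ _
    _ ≤ ∑ _h ∈ d.divisors, τ * (5 * q * Real.sqrt x / Real.sqrt d) := sum_le_sum hterm
    _ = 5 * q * Real.sqrt x * τ ^ 2 / Real.sqrt d := by
        rw [sum_const, nsmul_eq_mul, ← hτ]
        ring

end Literature.NumberTheory.LFunctions.RealChar
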